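/-
Copyright: b2b-lace packet (tail-bound analyst, gen 2). The orbit-average representation of
`(D̂^{(x)})²` and of `W_{n,2j}(x)` (KSUP.md §8 (W2)): a finite trigonometric identity over the
hyperoctahedral group, no Fourier inversion.
-/
import Literature.Probability.FitznerVanDerHofstad2017.SrwIntegralWSplit

/-!
# `(D̂^{(x)}(k))² = (2^d d!)⁻¹ Σ_{σ ∈ W_d} D̂^{(x - σx)}(k)` and `W_{n,2j}(x) = (2^d d!)⁻¹ Σ_σ I_{n,2j}(x - σx)`

`W_d` = signed permutations `σ = (ν, δ)` acting by `(σ x)_j = δ_j x_{ν j}` ([FvdH17-NoBLE] Def. 2.5).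
Squaring the orbit average `D̂^{(x)}(k) = |W_d|⁻¹ Σ_σ cos(k·σx)`, using
`2 cos a cos b = cos(a-b) + cos(a+b)`, the sign-flip symmetry `δ ↦ -δ` and the reindexing
`τ = σρ` gives the first identity pointwise in `k`; integrating against `D̂^{2j} Ĉⁿ` gives the second,
which for `j = 0` is the placement formula (5.16) for `L_n(x)`.
-/

namespace Literature.Probability.FitznerVanDerHofstad2017

open MeasureTheory Finset Real
open Literature.Barriers.CriticalPhenomena
open Literature.Barriers.CriticalPhenomena.Slade2006Prop53 (P)

variable {d : ℕ}

/-- Signed permutations as pairs `(ν, δ)`. [cite: FitznerVanDerHofstad2016NoBLE, Def. 2.5 p. 1058] -/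
abbrev SgnPermPair (d : ℕ) := Equiv.Perm (Fin d) × (Fin d → ℤˣ)

/-- The image `p(x; ν, δ)_i = δ_i x_{ν i}`. [cite: FitznerVanDerHofstad2016NoBLE, Def. 2.5 p. 1058] -/
def spAct (σ : SgnPermPair d) (x : Fin d → ℤ) : Fin d → ℤ := fun i => (σ.2 i : ℤ) * x (σ.1 i)

/-- Unfolding lemma for `spAct`. [folklore] -/
theorem spAct_apply (σ : SgnPermPair d) (x : Fin d → ℤ) (i : Fin d) :
    spAct σ x i = (σ.2 i : ℤ) * x (σ.1 i) := rfl

/-- The phase `k · p(x; ν, δ)`. [folklore] -/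
def phase (x : Fin d → ℤ) (k : Fin d → ℝ) (σ : SgnPermPair d) : ℝ :=
  ∑ j, (((σ.2 j : ℤ) : ℝ) * (x (σ.1 j) : ℝ)) * k j

/-- `D̂^{(x)}(k)` as a single sum over pairs. [cite: FitznerVanDerHofstad2016NoBLE, (3.34) p. 1071] -/
theorem DhatSym_eq_sum_pairs (x : Fin d → ℤ) (k : Fin d → ℝ) :
    DhatSym d x k = (∑ σ : SgnPermPair d, Real.cos (phase x k σ)) / (2 ^ d * (d.factorial : ℝ)) := by
  rw [DhatSym_def, Fintype.sum_prod_type]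
  rfl

/-- Composition `τ = σρ` in the pair parametrisation: `p(x; σρ) = M_σ p(x; ρ)`. [folklore] -/
def spMul (σ ρ : SgnPermPair d) : SgnPermPair d :=
  (ρ.1 * σ.1, fun j => σ.2 j * ρ.2 (σ.1 j))

/-- The inverse reindexing map. [folklore] -/
def spDiv (σ ρ' : SgnPermPair d) : SgnPermPair d :=
  (ρ'.1 * σ.1⁻¹, fun i => σ.2 (σ.1.symm i) * ρ'.2 (σ.1.symm i))

/-- `ρ ↦ σρ` is a bijection of `W_d`. [folklore] -/
theorem spMul_bijective (σ : SgnPermPair d) : Function.Bijective (spMul σ) := by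
  refine Function.bijective_iff_has_inverse.mpr ⟨spDiv σ, fun ρ => ?_, fun ρ' => ?_⟩
  · refine Prod.ext ?_ ?_
    · show (ρ.1 * σ.1) * σ.1⁻¹ = ρ.1
      exact mul_inv_cancel_right ρ.1 σ.1
    · funext i
      show σ.2 (σ.1.symm i) * (σ.2 (σ.1.symm i) * ρ.2 (σ.1 (σ.1.symm i))) = ρ.2 i
      rw [Equiv.apply_symm_apply, ← mul_assoc, Int.units_mul_self, one_mul]
  · refine Prod.ext ?_ ?_
    · show (ρ'.1 * σ.1⁻¹) * σ.1 = ρ'.1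
      exact inv_mul_cancel_right ρ'.1 σ.1
    · funext j
      show σ.2 j * (σ.2 (σ.1.symm (σ.1 j)) * ρ'.2 (σ.1.symm (σ.1 j))) = ρ'.2 j
      rw [Equiv.symm_apply_apply, ← mul_assoc, Int.units_mul_self, one_mul]

/-- Sign flip `δ ↦ -δ`. [folklore] -/
def spNeg (τ : SgnPermPair d) : SgnPermPair d := (τ.1, -τ.2)

/-- The sign flip is a bijection (an involution). [folklore] -/
theorem spNeg_bijective : Function.Bijective (spNeg (d := d)) := by
  refine Function.bijective_iff_has_inverse.mpr ⟨spNeg, fun τ => ?_, fun τ => ?_⟩ <;>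
  · refine Prod.ext rfl ?_
    show -(-τ.2) = τ.2
    exact neg_neg τ.2

/-- `k·p(x; ν, -δ) = -k·p(x; ν, δ)`. [folklore] -/
theorem phase_spNeg (x : Fin d → ℤ) (k : Fin d → ℝ) (τ : SgnPermPair d) :
    phase x k (spNeg τ) = -phase x k τ := by
  unfold phase spNeg
  rw [← Finset.sum_neg_distrib]
  refine Finset.sum_congr rfl fun j _ => ?_
  simp only [Pi.neg_apply, Units.val_neg, Int.cast_neg]
  ring

/-- `k·p(x;σ) - k·p(x;σρ) = k·p(x - p(x;ρ); σ)` (linearity of `M_σ`). [folklore] -/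
theorem phase_sub_phase_spMul (x : Fin d → ℤ) (k : Fin d → ℝ) (σ ρ : SgnPermPair d) :
    phase x k σ - phase x k (spMul σ ρ) = phase (x - spAct ρ x) k σ := by
  unfold phase spMul
  rw [← Finset.sum_sub_distrib]
  refine Finset.sum_congr rfl fun j _ => ?_
  simp only [Equiv.Perm.mul_apply, Units.val_mul, Int.cast_mul, Pi.sub_apply, spAct_apply,
    Int.cast_sub]
  ring

/-- THE SQUARE IDENTITY (sum form): `(Σ_σ cos k·σx)² = Σ_ρ Σ_σ cos k·σ(x - ρx)`. [folklore] -/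
theorem sum_cos_phase_sq (x : Fin d → ℤ) (k : Fin d → ℝ) :
    (∑ σ : SgnPermPair d, Real.cos (phase x k σ)) ^ 2 =
      ∑ ρ : SgnPermPair d, ∑ σ : SgnPermPair d, Real.cos (phase (x - spAct ρ x) k σ) := by
  set φ := phase x k with hφ
  have hcc : ∀ a b : ℝ, Real.cos a * Real.cos b = (Real.cos (a - b) + Real.cos (a + b)) / 2 :=
    fun a b => by rw [Real.cos_sub, Real.cos_add]; ring
  have hneg : ∀ σ : SgnPermPair d,
      ∑ τ : SgnPermPair d, Real.cos (φ σ + φ τ) = ∑ τ : SgnPermPair d, Real.cos (φ σ - φ τ) := by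
    intro σ
    rw [← spNeg_bijective.sum_comp (fun τ => Real.cos (φ σ + φ τ))]
    refine Finset.sum_congr rfl fun τ _ => ?_
    simp only [hφ, phase_spNeg, ← sub_eq_add_neg]
  have hmul : ∀ σ : SgnPermPair d,
      ∑ τ : SgnPermPair d, Real.cos (φ σ - φ τ) =
        ∑ ρ : SgnPermPair d, Real.cos (phase (x - spAct ρ x) k σ) := by
    intro σ
    rw [← (spMul_bijective σ).sum_comp (fun τ => Real.cos (φ σ - φ τ))]
    refine Finset.sum_congr rfl fun ρ _ => ?_
    simp only [hφ, phase_sub_phase_spMul]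
  calc (∑ σ, Real.cos (φ σ)) ^ 2
      = ∑ σ, ∑ τ, Real.cos (φ σ) * Real.cos (φ τ) := by rw [sq, Finset.sum_mul_sum]
    _ = ∑ σ, ∑ τ, (Real.cos (φ σ - φ τ) + Real.cos (φ σ + φ τ)) / 2 := by
        simp only [hcc]
    _ = ∑ σ, ((∑ τ, Real.cos (φ σ - φ τ)) + ∑ τ, Real.cos (φ σ + φ τ)) / 2 := by
        refine Finset.sum_congr rfl fun σ _ => ?_
        rw [← Finset.sum_add_distrib, Finset.sum_div]
    _ = ∑ σ, ∑ τ, Real.cos (φ σ - φ τ) := by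
        refine Finset.sum_congr rfl fun σ _ => ?_
        rw [hneg σ]; ring
    _ = ∑ σ, ∑ ρ, Real.cos (phase (x - spAct ρ x) k σ) := by
        refine Finset.sum_congr rfl fun σ _ => hmul σ
    _ = ∑ ρ, ∑ σ, Real.cos (phase (x - spAct ρ x) k σ) := Finset.sum_comm

/-- THE SQUARE IDENTITY: `(D̂^{(x)}(k))² = (2^d d!)⁻¹ Σ_{ρ ∈ W_d} D̂^{(x - ρx)}(k)` pointwise in `k`.
(b2b-lace KSUP.md §8 (W2).) [folklore] -/
theorem DhatSym_sq_eq_orbit_sum (x : Fin d → ℤ) (k : Fin d → ℝ) :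
    DhatSym d x k ^ 2 =
      (∑ ρ : SgnPermPair d, DhatSym d (x - spAct ρ x) k) / (2 ^ d * (d.factorial : ℝ)) := by
  have hN : (2 : ℝ) ^ d * (d.factorial : ℝ) ≠ 0 := by positivity
  rw [DhatSym_eq_sum_pairs]
  simp_rw [DhatSym_eq_sum_pairs]
  rw [← Finset.sum_div, div_pow, sum_cos_phase_sq, div_div, ← sq]


/-- `W_{n,2j}(x) = (2^d d!)⁻¹ Σ_{ρ ∈ W_d} I_{n,2j}(x - ρ x)` — the placement formula, all `j`.
[cite: FitznerVanDerHofstad2016NoBLE, (5.16) p. 1092] -/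
theorem srwW_eq_orbit_sum {n : ℕ} (hd : 2 * n + 1 ≤ d) (j : ℕ) (x : Fin d → ℤ) :
    srwW d n j x =
      (∑ ρ : SgnPermPair d, srwI d n (2 * j) (x - spAct ρ x)) / (2 ^ d * (d.factorial : ℝ)) := by
  have hN : (2 : ℝ) ^ d * (d.factorial : ℝ) ≠ 0 := by positivity
  unfold srwW srwI
  have hpt : ∀ k, (Dhat d k ^ (2 * j) * DhatSym d x k ^ 2) * Chat d 1 k ^ n =
      (∑ ρ : SgnPermPair d, (Dhat d k ^ (2 * j) * DhatSym d (x - spAct ρ x) k) * Chat d 1 k ^ n) /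
        (2 ^ d * (d.factorial : ℝ)) := by
    intro k
    rw [DhatSym_sq_eq_orbit_sum, Finset.sum_div, Finset.mul_sum, Finset.sum_mul, Finset.sum_div]
    refine Finset.sum_congr rfl fun ρ _ => ?_
    ring
  simp_rw [hpt]
  rw [integral_div, integral_finsetSum _ (fun ρ _ => integrable_srwI_integrand hd (2 * j) _),
    Finset.sum_div, Finset.sum_div, Finset.sum_div]
  refine Finset.sum_congr rfl fun ρ _ => ?_
  rw [div_div, div_div, mul_comm ((2 : ℝ) ^ d * (d.factorial : ℝ)) ((2 * π) ^ d)]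

end Literature.Probability.FitznerVanDerHofstad2017
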